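import Literature.NumberTheory.CubicFields.PureCubicLexMinProgram
import Literature.Computability.Complexity.CodeFPLists
import Literature.Computability.Complexity.NatCbrtFP
import HarnessLib

/-!
# The program `lexE` is typed polynomial time

Topic `NumberTheory/CubicFields`, sub-namespace `PureCubicLexMin`: the polynomial-time realisation on
codes (`CodeFP`, `CodeFP.lean`) of the program of `PureCubicLexMinProgram.lean` computing the least
cylinder element of a lattice of a pure cubic field. Everything is assembled from the typed
combinators of the kit: the register expressions through `RegProg.Ex.code` (`evalList_codeFP`),
the rounding constants through `natCbrtScaled` / `natSqrt` / `natPow` (`regs0_codeFP`), the LLL stage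
through the tree's machine (`SimApproxLLL.lllOutFP`, with `GapCodes.rowsOfFlat_codeFP`,
`latticeTableFP`, `SimApproxLLL.flatFP`: `lll9_codeFP`), the enumeration, the exact filters and the
selection through `map`, `flatten`, `filter`, `all`, `rawCases` (`perScale_codeFP`, `allCands_codeFP`,
`validCands_codeFP`, `minCands_codeFP`, **`lexE_codeFP`**). No size estimate is written: the only
accumulator bounds are inside the kit.

## References

* S. Arora, B. Barak, *Computational Complexity: A Modern Approach*, CUP 2009, §1.3 (closure of
  polynomial time under composition and polynomially bounded loops). [AroraBarak2009]
* A. K. Lenstra, H. W. Lenstra, L. Lovász, Math. Ann. 261 (1982), Prop. 1.26. [LenstraLenstraLovasz1982]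
-/

noncomputable section

namespace Literature.NumberTheory.CubicFields

namespace PureCubicLexMin

open Literature.Computability.Complexity Literature.Computability.Complexity.CodeFP
  Literature.Computability.Complexity.RegProg Literature.Computability.Complexity.LMat
  Literature.Algebra.EuclideanLattices Literature.Algebra.EuclideanLattices.GapCodes

/-! ### Register expressions, lists of them -/

/-- **A fixed list of register expressions** is evaluated (to a raw list of integers) in typed
polynomial time. [cite: AroraBarak2009, §1.3] -/
theorem evalList_codeFP : ∀ es : List Ex, CodeFP stE (rawE intE) (fun p => es.map (Ex.eval p.1 p.2))
  | [] => const _ []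
  | e :: es => ((rawCons intE).comp (e.code.pair (evalList_codeFP es))).congr fun _ => rfl

/-- Evaluation of a fixed list of expressions with run parameter `0` on a computed register file.
[cite: AroraBarak2009, §1.3] -/
theorem evalList₀_codeFP {β : Type} {eβ : β → List Bool} {regs : β → List ℤ}
    (h : CodeFP eβ (rawE intE) regs) (es : List Ex) :
    CodeFP eβ (rawE intE) (fun x => es.map (Ex.eval 0 (regs x))) :=
  ((evalList_codeFP es).comp ((const eβ (0 : ℕ)).pair h) :)

/-! ### The initial register file -/

/-- **`regs0` on codes.** [cite: AroraBarak2009, §1.3] -/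
theorem regs0_codeFP : CodeFP (pairE inE (pairE unE intE)) (rawE intE) (fun q => regs0 q.1 q.2.1 q.2.2) := by
  have qa : CodeFP (pairE inE (pairE unE intE)) natE (fun q => q.1.1.1) := ((fst _ _).fst'.fst' :)
  have qb : CodeFP (pairE inE (pairE unE intE)) natE (fun q => q.1.1.2) := ((fst _ _).fst'.snd' :)
  have qden : CodeFP (pairE inE (pairE unE intE)) natE (fun q => q.1.2.1) := ((fst _ _).snd'.fst' :)
  have qhs : CodeFP (pairE inE (pairE unE intE)) (rawE intE) (fun q => q.1.2.2) := ((fst _ _).snd'.snd' :)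
  have qN : CodeFP (pairE inE (pairE unE intE)) unE (fun q => q.2.1) := ((snd _ _).fst' :)
  have qs : CodeFP (pairE inE (pairE unE intE)) intE (fun q => q.2.2) := ((snd _ _).snd' :)
  have qab2 : CodeFP (pairE inE (pairE unE intE)) natE (fun q => q.1.1.1 * q.1.1.2 ^ 2) :=
    (natMul.comp (qa.pair (natPow.comp (qb.pair (const _ (2 : ℕ))))) :)
  have qa2b : CodeFP (pairE inE (pairE unE intE)) natE (fun q => q.1.1.1 ^ 2 * q.1.1.2) :=
    (natMul.comp ((natPow.comp (qa.pair (const _ (2 : ℕ)))).pair qb) :)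
  have qT1 : CodeFP (pairE inE (pairE unE intE)) intE (fun q => (Nat.nthRoot 3 (q.1.1.1 * q.1.1.2 ^ 2 * 8 ^ q.2.1) : ℤ)) :=
    (intOfNat.comp (natCbrtScaled.comp (qab2.pair qN)) :)
  have qT2 : CodeFP (pairE inE (pairE unE intE)) intE (fun q => (Nat.nthRoot 3 (q.1.1.1 ^ 2 * q.1.1.2 * 8 ^ q.2.1) : ℤ)) :=
    (intOfNat.comp (natCbrtScaled.comp (qa2b.pair qN)) :)
  have qS3 : CodeFP (pairE inE (pairE unE intE)) intE (fun q => (Nat.sqrt (3 * 4 ^ q.2.1) : ℤ)) :=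
    (intOfNat.comp (natSqrt.comp (natMul.comp ((const _ (3 : ℕ)).pair (natPow.comp ((const _ (4 : ℕ)).pair qN))))) :)
  have qNz : CodeFP (pairE inE (pairE unE intE)) intE (fun q => (q.2.1 : ℤ)) := (intOfNat.comp (natOfUn.comp qN) :)
  have qtail : CodeFP (pairE inE (pairE unE intE)) (rawE intE) (fun q => [q.2.2, (q.2.1 : ℤ),
      (Nat.nthRoot 3 (q.1.1.1 * q.1.1.2 ^ 2 * 8 ^ q.2.1) : ℤ),
      (Nat.nthRoot 3 (q.1.1.1 ^ 2 * q.1.1.2 * 8 ^ q.2.1) : ℤ), (Nat.sqrt (3 * 4 ^ q.2.1) : ℤ)]) :=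
    ((rawCons intE).comp (qs.pair ((rawCons intE).comp (qNz.pair ((rawCons intE).comp (qT1.pair
      ((rawCons intE).comp (qT2.pair ((rawCons intE).comp (qS3.pair (const _ ([] : List ℤ))))))))))) :)
  have qhead : CodeFP (pairE inE (pairE unE intE)) (rawE intE) (fun q => [(q.1.1.1 : ℤ), (q.1.1.2 : ℤ), (q.1.2.1 : ℤ)]) :=
    ((rawCons intE).comp ((intOfNat.comp qa).pair ((rawCons intE).comp ((intOfNat.comp qb).pair
      ((rawCons intE).comp ((intOfNat.comp qden).pair (const _ ([] : List ℤ))))))) :)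
  have h := ((rawAppend intE).comp (((rawAppend intE).comp (qhead.pair qhs)).pair qtail) :)
  exact h.congr fun q => rfl

/-- **The rounded matrix `B̃` on codes.** [cite: AroraBarak2009, §1.3] -/
theorem bt_codeFP : CodeFP (pairE inE (pairE unE intE)) (rawE intE) (fun q => btExprs.map (Ex.eval q.2.1 (regs0 q.1 q.2.1 q.2.2))) :=
  ((evalList_codeFP btExprs).comp ((snd _ _).fst'.pair regs0_codeFP) :)

/-! ### The LLL stage -/

/-- Headed sign–magnitude lists to raw difference-pair lists. [folklore] -/
theorem listItems_codeFP : CodeFP (listE smE) (rawE intE) (fun l => l) :=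
  ((map₀ intOfSM).comp (rawOfList smE)).congr fun l => by simp

/-- **`lll9` on codes**: the row-major entries of the LLL machine output on the `3 × 3` matrix of a
flat list (LLL82 Prop. 1.26 through `SimApproxLLL.lllOutFP`). [cite: LenstraLenstraLovasz1982, Prop. 1.26] -/
theorem lll9_codeFP : CodeFP (rawE intE) (rawE intE) lll9 := by
  have h3 : CodeFP (rawE intE) unE (fun _ => 3) := const _ 3
  have hrows : CodeFP (rawE intE) matE (fun bt => rowsOfFlat 3 bt) := (rowsOfFlat_codeFP.comp (h3.pair (CodeFP.id _)) :)
  have hinst : CodeFP (rawE intE) strE (fun bt => LatticeInstance.encode ⟨3, toMat 3 3 (rowsOfFlat 3 bt)⟩) :=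
    (latticeTableFP.comp (h3.pair hrows) :)
  have hinst' : CodeFP (rawE intE) LatticeInstance.encode (fun bt => (⟨3, toMat 3 3 (rowsOfFlat 3 bt)⟩ : LatticeInstance)) :=
    hinst.recodeOut fun _ => rfl
  have hl : CodeFP (rawE intE) LatticeInstance.encode (fun bt => SimApproxLLL.lllOut ⟨3, toMat 3 3 (rowsOfFlat 3 bt)⟩) :=
    (SimApproxLLL.lllOutFP.comp hinst' :)
  have hf : CodeFP (rawE intE) (listE smE) (fun bt => SimApproxLLL.flatOf (SimApproxLLL.lllOut ⟨3, toMat 3 3 (rowsOfFlat 3 bt)⟩)) :=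
    ((SimApproxLLL.flatFP.comp hl).snd' :)
  exact ((listItems_codeFP.comp hf).congr fun _ => rfl :)

/-! ### One scale -/

/-- **`perScale` on codes.** [cite: AroraBarak2009, §1.3] -/
theorem perScale_codeFP : CodeFP (pairE inE (pairE unE intE)) (rawE (rawE intE)) (fun q => perScale q.1 q.2.1 q.2.2) := by
  have hbt := bt_codeFP
  have hbl : CodeFP (pairE inE (pairE unE intE)) (rawE intE) (fun q => btExprs.map (Ex.eval q.2.1 (regs0 q.1 q.2.1 q.2.2)) ++
      lll9 (btExprs.map (Ex.eval q.2.1 (regs0 q.1 q.2.1 q.2.2)))) :=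
    ((rawAppend intE).comp (hbt.pair (lll9_codeFP.comp hbt)) :)
  have hu := evalList₀_codeFP hbl uExprs
  have hhs : CodeFP (pairE inE (pairE unE intE)) (rawE intE) (fun q => q.1.2.2) := ((fst _ _).snd'.snd' :)
  have huh := ((rawAppend intE).comp (hu.pair hhs) :)
  have hr := evalList₀_codeFP huh rExprs
  -- the enumeration: context `r`, items `c ∈ box`
  have hitem : CodeFP (pairE (rawE intE) (rawE intE)) (rawE intE)
      (fun t => wExprs.map (Ex.eval 0 (t.2 ++ t.1))) :=
    evalList₀_codeFP ((rawAppend intE).comp ((snd _ _).pair (fst _ _))) wExprs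
  have hmap := ((map hitem).comp (hr.pair (const (pairE inE (pairE unE intE)) box)) :)
  exact hmap.congr fun q => rfl

attribute [local irreducible] perScale

/-! ### The scan over the scales -/

/-- The code itself, as a string. [folklore] -/
theorem self_codeFP : CodeFP inE strE (fun inp => inE inp) := transparent fun _ => rfl

/-- The length `L` of the input code, in unary. [folklore] -/
theorem len_codeFP : CodeFP inE unE (fun inp => (inE inp).length) := (strLength.comp self_codeFP :)

/-- **The budget `N = 16L + 64`** in unary. [folklore] -/
theorem budget_codeFP : CodeFP inE unE budget := by
  have h1 := len_codeFP
  have h2 : CodeFP inE unE (fun inp => (inE inp).length + (inE inp).length) := (unAdd.comp (h1.pair h1) :)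
  have h4 : CodeFP inE unE (fun inp => ((inE inp).length + (inE inp).length) + ((inE inp).length + (inE inp).length)) :=
    (unAdd.comp (h2.pair h2) :)
  have h8 := (unAdd.comp (h4.pair h4) :)
  have h16 := (unAdd.comp (h8.pair h8) :)
  have h := (unAdd.comp (h16.pair (const inE (64 : ℕ))) :)
  exact h.congr fun inp => by simp only [budget]; omega

/-- **The half-width `S = 3L + 8`** in unary. [folklore] -/
theorem halfWidth_codeFP : CodeFP inE unE halfWidth := by
  have h1 := len_codeFP
  have h2 : CodeFP inE unE (fun inp => (inE inp).length + (inE inp).length) := (unAdd.comp (h1.pair h1) :)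
  have h3 : CodeFP inE unE (fun inp => ((inE inp).length + (inE inp).length) + (inE inp).length) :=
    (unAdd.comp (h2.pair h1) :)
  have h := (unAdd.comp (h3.pair (const inE (8 : ℕ))) :)
  exact h.congr fun inp => by simp only [halfWidth]; omega

attribute [local irreducible] budget halfWidth

/-- The elementwise coercion `List ℕ → List ℤ` is a `map`. [folklore] -/
theorem coe_list_eq_map (l : List ℕ) : ((l : List ℤ)) = l.map (fun a : ℕ => (a : ℤ)) := by
  induction l with
  | nil => rfl
  | cons a l ih =>
    show (a : ℤ) :: ((l : List ℤ)) = _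
    rw [ih, List.map_cons]

/-- **All candidates** on codes (a `map` over the unary range of scales, then `flatten`).
[cite: AroraBarak2009, §1.3] -/
theorem allCands_codeFP : CodeFP inE (rawE (rawE intE)) allCands := by
  have hS := halfWidth_codeFP
  have hcount0 : CodeFP inE unE (fun inp => halfWidth inp + halfWidth inp + 1) :=
    (unSucc.comp (unAdd.comp (hS.pair hS)) :)
  have hcount : CodeFP inE unE (fun inp => 2 * halfWidth inp + 1) := hcount0.congr fun inp => by omega
  have hrange : CodeFP inE (rawE natE) (fun inp => List.range (2 * halfWidth inp + 1)) := (urange.comp hcount :)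
  have hrangeZ : CodeFP inE (rawE intE) (fun inp => ((List.range (2 * halfWidth inp + 1) : List ℕ) : List ℤ)) :=
    ((map₀ intOfNat).comp hrange).congr fun inp => (coe_list_eq_map _).symm
  -- the item: `(inp, k) ↦ perScale inp N (k - S)`
  have tinp : CodeFP (pairE inE intE) inE (fun t => t.1) := fst _ _
  have tN : CodeFP (pairE inE intE) unE (fun t => budget t.1) := (budget_codeFP.comp tinp :)
  have tS : CodeFP (pairE inE intE) intE (fun t => ((halfWidth t.1 : ℕ) : ℤ)) :=
    (intOfNat.comp (natOfUn.comp (halfWidth_codeFP.comp tinp)) :)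
  have ts : CodeFP (pairE inE intE) intE (fun t => t.2 - halfWidth t.1) := (intSub.comp ((snd _ _).pair tS) :)
  have titem : CodeFP (pairE inE intE) (rawE (rawE intE)) (fun t => perScale t.1 (budget t.1) (t.2 - halfWidth t.1)) :=
    (perScale_codeFP.comp (tinp.pair (tN.pair ts)) :)
  have hmap := ((map titem).comp ((CodeFP.id inE).pair hrangeZ) :)
  have hflat := ((flatten (rawE intE)).comp hmap :)
  exact hflat.congr fun inp => by unfold allCands; rfl

attribute [local irreducible] allCands

/-! ### The exact filters and the selection -/

/-- **The cylinder test on codes.** [cite: AroraBarak2009, §1.3] -/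
theorem inCyl_codeFP : CodeFP (pairE inE (rawE intE)) bitE (fun t => inCyl t.1 t.2) := by
  have qa : CodeFP (pairE inE (rawE intE)) intE (fun t => (t.1.1.1 : ℤ)) := (intOfNat.comp (fst _ _).fst'.fst' :)
  have qb : CodeFP (pairE inE (rawE intE)) intE (fun t => (t.1.1.2 : ℤ)) := (intOfNat.comp (fst _ _).fst'.snd' :)
  have qd : CodeFP (pairE inE (rawE intE)) intE (fun t => (t.1.2.1 : ℤ)) := (intOfNat.comp (fst _ _).snd'.fst' :)
  have qregs : CodeFP (pairE inE (rawE intE)) (rawE intE)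
      (fun t => t.2 ++ [(t.1.1.1 : ℤ), (t.1.1.2 : ℤ), (t.1.2.1 : ℤ)]) :=
    ((rawAppend intE).comp ((snd _ _).pair ((rawCons intE).comp (qa.pair ((rawCons intE).comp (qb.pair
      ((rawCons intE).comp (qd.pair (const _ ([] : List ℤ))))))))) :)
  have qst : CodeFP (pairE inE (rawE intE)) stE (fun t => ((0 : ℕ), t.2 ++ [(t.1.1.1 : ℤ), (t.1.1.2 : ℤ), (t.1.2.1 : ℤ)])) :=
    ((const _ (0 : ℕ)).pair qregs :)
  have h1 : CodeFP (pairE inE (rawE intE)) bitE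
      (fun t => decide (0 < nrmW.eval 0 (t.2 ++ [(t.1.1.1 : ℤ), (t.1.1.2 : ℤ), (t.1.2.1 : ℤ)]))) :=
    (intLt.comp ((const _ (0 : ℤ)).pair (nrmW.code.comp qst)) :)
  have h2 : CodeFP (pairE inE (rawE intE)) bitE
      (fun t => decide (0 < cylW.eval 0 (t.2 ++ [(t.1.1.1 : ℤ), (t.1.1.2 : ℤ), (t.1.2.1 : ℤ)]))) :=
    (intLt.comp ((const _ (0 : ℤ)).pair (cylW.code.comp qst)) :)
  exact (h1.and h2).congr fun t => rfl

attribute [local irreducible] inCyl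

/-- **The comparison on codes.** [cite: AroraBarak2009, §1.3] -/
theorem isLt_codeFP : CodeFP (pairE inE (pairE (rawE intE) (rawE intE))) bitE (fun t => isLt t.1 t.2.1 t.2.2) := by
  have qa : CodeFP (pairE inE (pairE (rawE intE) (rawE intE))) intE (fun t => (t.1.1.1 : ℤ)) :=
    (intOfNat.comp (fst _ _).fst'.fst' :)
  have qb : CodeFP (pairE inE (pairE (rawE intE) (rawE intE))) intE (fun t => (t.1.1.2 : ℤ)) :=
    (intOfNat.comp (fst _ _).fst'.snd' :)
  have qregs : CodeFP (pairE inE (pairE (rawE intE) (rawE intE))) (rawE intE)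
      (fun t => t.2.1 ++ t.2.2 ++ [(t.1.1.1 : ℤ), (t.1.1.2 : ℤ)]) :=
    ((rawAppend intE).comp (((rawAppend intE).comp ((snd _ _).fst'.pair (snd _ _).snd')).pair
      ((rawCons intE).comp (qa.pair ((rawCons intE).comp (qb.pair (const _ ([] : List ℤ))))))) :)
  have qst : CodeFP (pairE inE (pairE (rawE intE) (rawE intE))) stE
      (fun t => ((0 : ℕ), t.2.1 ++ t.2.2 ++ [(t.1.1.1 : ℤ), (t.1.1.2 : ℤ)])) := ((const _ (0 : ℕ)).pair qregs :)
  have h : CodeFP (pairE inE (pairE (rawE intE) (rawE intE))) bitE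
      (fun t => decide (ltW.eval 0 (t.2.1 ++ t.2.2 ++ [(t.1.1.1 : ℤ), (t.1.1.2 : ℤ)]) < 0)) :=
    (intLt.comp ((ltW.code.comp qst).pair (const _ (0 : ℤ))) :)
  exact h.congr fun t => rfl

attribute [local irreducible] isLt

/-- **The candidates in the cylinder, on codes.** [cite: AroraBarak2009, §1.3] -/
theorem validCands_codeFP : CodeFP inE (rawE (rawE intE)) validCands := by
  have h := ((filter inCyl_codeFP).comp ((CodeFP.id inE).pair allCands_codeFP) :)
  exact h.congr fun _ => by unfold validCands; rfl

attribute [local irreducible] validCands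

/-- **The minimal candidates, on codes** (`filter` of an `all`). [cite: AroraBarak2009, §1.3] -/
theorem minCands_codeFP : CodeFP inE (rawE (rawE intE)) minCands := by
  -- context `σ' = (inp, w)`, items `w' ∈ valid`
  have hp : CodeFP (pairE (pairE inE (rawE intE)) (rawE intE)) bitE (fun t => !isLt t.1.1 t.2 t.1.2) :=
    ((isLt_codeFP.comp ((fst _ _).fst'.pair ((snd _ _).pair (fst _ _).snd'))).not :)
  have hall := all hp
  -- the filter predicate: context `(inp, valid)`, item `w`
  have hpred : CodeFP (pairE (pairE inE (rawE (rawE intE))) (rawE intE)) bitE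
      (fun t => t.1.2.all fun w' => !isLt t.1.1 w' t.2) :=
    (hall.comp ((((fst _ _).fst').pair (snd _ _)).pair (fst _ _).snd') :)
  have hv := validCands_codeFP
  have h := ((filter hpred).comp ((((CodeFP.id inE).pair hv)).pair hv) :)
  exact h.congr fun _ => by unfold minCands; rfl

attribute [local irreducible] minCands

/-- **The program `lexE` is typed polynomial time** on the codes
`((a, b), (den, [h11, …, h33])) ↦ (x, y, z, den)`. [cite: AroraBarak2009, §1.3] -/
theorem lexE_codeFP : CodeFP inE (pairE intE (pairE intE (pairE intE natE))) lexE := by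
  let outE : ℤ × ℤ × ℤ × ℕ → List Bool := pairE intE (pairE intE (pairE intE natE))
  have hnil : CodeFP inE outE (fun _ => ((0 : ℤ), (0 : ℤ), (0 : ℤ), (1 : ℕ))) := const _ _
  -- cons case: context `inp`, head `w`, tail
  let cE : (((ℕ × ℕ) × (ℕ × List ℤ)) × List ℤ × List (List ℤ)) → List Bool :=
    pairE inE (pairE (rawE intE) (rawE (rawE intE)))
  have qw : CodeFP cE (rawE intE) (fun t => t.2.1) := ((snd _ _).fst' :)
  have qden : CodeFP cE natE (fun t => t.1.2.1) := ((fst _ _).snd'.fst' :)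
  have qget : ∀ i : ℕ, CodeFP cE intE (fun t => t.2.1.getD i 0) := fun i =>
    ((rawGetOr intE).comp (qw.pair ((const _ i).pair (const _ (0 : ℤ)))) :)
  have hcons : CodeFP cE outE (fun t => (t.2.1.getD 0 0, t.2.1.getD 1 0, t.2.1.getD 2 0, t.1.2.1)) :=
    ((qget 0).pair ((qget 1).pair ((qget 2).pair qden)) :)
  have h := rawCases (eσ := inE) (eα := rawE intE) (eδ := outE)
    (k := fun inp l => match l with
      | [] => ((0 : ℤ), (0 : ℤ), (0 : ℤ), (1 : ℕ))
      | w :: _ => (w.getD 0 0, w.getD 1 0, w.getD 2 0, inp.2.1))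
    hnil hcons (fun _ => rfl) (fun _ _ _ => rfl)
  have h' := (h.comp ((CodeFP.id inE).pair minCands_codeFP) :)
  refine h'.congr fun inp => ?_
  unfold lexE
  generalize minCands inp = l
  cases l <;> rfl

end PureCubicLexMin

end Literature.NumberTheory.CubicFields

end
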